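import Literature.Analysis.FluidPDE.TimePeriodicNSLattice
import Literature.Analysis.FunctionSpaces.TorusTimePeriodicLift
import Literature.Analysis.FunctionSpaces.TorusFourierSynthesis
import Literature.Analysis.FunctionSpaces.TorusVectorParseval
import HarnessLib

/-!
# Time-periodic Navier–Stokes on `T³` in space–time Fourier coefficients, V: lattice families
# versus coefficient families on `ℤ⁴`, real syntheses, and the slice `H¹` bound
# (Iooss 1972; Henry 1981, Ch. 8; Kielhöfer 2012, §I.8)

Analysis/FluidPDE proof file (theorems only; no definitions, no named facts), sequel of
`TimePeriodicNSLattice` and of the glue file `FunctionSpaces/TorusTimePeriodicLift` on the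
discharge path of `Literature.Analysis.FluidPDE.PeriodicNSOrbitPersists`. The lattice files work with families on
`𝕃 = ℤ × ℤ³` weighted by `Λ(n,k) = |n| + |k|²`; smooth `1`-periodic space–time fields are read
on the torus `T⁴ = UnitAddTorus (Fin 4)` with coefficient families on `ℤ⁴` (`Fin 4 → ℤ`). This
file is the bookkeeping between the two and the two analytic facts about syntheses that the
assembly needs:

* §A the reindexing `K = Fin.cons n k`: parabolic moments `∑ Λ^N |x|² < ∞` of a lattice family
  `x = Λ v̂` versus rapid decay (`Torus.RapidDecay`) of the coefficient family `v̂` on `ℤ⁴`, in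
  both directions (`moments_of_rapidDecay`, `rapidDecay_of_moments`), and the weighted `ℓ¹`
  bound `∑ (1+Λ)⟨k⟩ |v̂| < ∞` of rapidly decaying families (the compactness hypothesis of
  `TimePeriodicNSLatticeCompact`);
* §B **real syntheses**: the Fourier synthesis on `T^d` of a summable conjugate-symmetric
  `ℂ^ι`-valued family is real (`conjVec_fourierSynth_of_symm`), so that `complexify ∘ Re F_c = F_c`;
* §C the **slice `H¹` bound**: if a smooth real field `D` on `T⁴` has coefficients `e/Λ` with
  `e ∈ ℓ²(𝕃)` vanishing on the zero spatial modes, then every time slice satisfies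
  `∫ |D(c,·)|² + ‖∇D(c,·)‖₂² ≤ 3(1 + 4π²) ∑ |e|²` — the embedding of the maximal-regularity
  class into `C(S¹; H¹(T³))` on the Fourier side (Iooss 1972, §2), which converts closeness in
  `W` into the uniform-in-time `H¹` closeness of the conclusion of the fact.

## References

* G. Iooss, Arch. Rational Mech. Anal. 47 (1972) 301–329, §2. [Iooss1972]
* D. Henry, *Geometric Theory of Semilinear Parabolic Equations*, LNM 840 (1981), Ch. 8. [Henry1981]
* H. Kielhöfer, *Bifurcation Theory*, 2nd ed. (2012), §I.8. [Kielhofer2012]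
* L. Grafakos, *Classical Fourier Analysis*, 3rd ed. (2014), §3.1–3.3. [Grafakos2014]
-/

noncomputable section

open scoped BigOperators Topology ENNReal NNReal ComplexConjugate
open Filter Set Function MeasureTheory UnitAddTorus

namespace Literature.Analysis.FluidPDE

namespace TimePeriodicLattice

open Literature.Analysis.FunctionSpaces Literature.Analysis.FunctionSpaces.Torus
open Literature.Analysis.FunctionSpaces.EuclideanSpace
open Literature.Analysis.FluidPDE.ScalarFourier

-- BODY START
-- NOTATION START
/-- Local notation: the parabolic weight `Λ(n, k) = |n| + |k|²`. -/
local notation:max "Λ" m:max => (|((Prod.fst m : ℤ) : ℝ)| + freqNormSq (Prod.snd m))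

/-- Local notation: division by the weight (as in `TimePeriodicNSLattice`). -/
local notation:max "𝐜" x:max => (fun mm : ℤ × (Fin 3 → ℤ) =>
  ((((|((Prod.fst mm : ℤ) : ℝ)| + freqNormSq (Prod.snd mm))⁻¹ : ℝ) : ℂ) • x mm))
-- NOTATION END

/-! ## §A⁗ Lattice families on `ℤ × ℤ³` versus coefficient families on `ℤ⁴` -/

section Reindex

/-- The weight is dominated by the Japanese bracket of the space–time frequency:
`Λ(n,k) ≤ 1 + |(n,k)|²`. [folklore] -/
theorem wt_le_one_add_freqNormSq_cons (m : ℤ × (Fin 3 → ℤ)) :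
    Λ m ≤ 1 + freqNormSq (Fin.cons m.1 m.2 : Fin 4 → ℤ) := by
  rw [freqNormSq_cons]
  have := abs_intCast_le_sq_add_one m.1
  linarith

/-- Conversely, off the zero spatial modes `1 + |(n,k)|² ≤ 4 Λ(n,k)²`. [folklore] -/
theorem one_add_freqNormSq_cons_le {m : ℤ × (Fin 3 → ℤ)} (hm : m.2 ≠ 0) :
    1 + freqNormSq (Fin.cons m.1 m.2 : Fin 4 → ℤ) ≤ 4 * (Λ m) ^ 2 := by
  rw [freqNormSq_cons]
  have h1 : 1 ≤ freqNormSq m.2 := Torus.one_le_freqNormSq hm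
  have h2 : 0 ≤ |((m.1 : ℤ) : ℝ)| := abs_nonneg _
  have h3 : ((m.1 : ℤ) : ℝ) ^ 2 = |((m.1 : ℤ) : ℝ)| ^ 2 := (sq_abs _).symm
  rw [h3]
  nlinarith

/-- **Parabolic moments from rapid decay**: if `C` is rapidly decaying on `ℤ⁴` then the lattice
family `x(n,k) = Λ(n,k) C(n,k)` has all moments `∑ Λ^N ‖x‖² < ∞`. [folklore] -/
theorem moments_of_rapidDecay {C : (Fin 4 → ℤ) → EuclideanSpace ℂ (Fin 3)} (hC : RapidDecay C) (N : ℕ) :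
    ∑' m : ℤ × (Fin 3 → ℤ), ENNReal.ofReal ((Λ m) ^ N) *
        ‖(((Λ m : ℝ) : ℂ)) • C (Fin.cons m.1 m.2)‖ₑ ^ 2 ≠ ⊤ := by
  have hs := hC (N + 2)
  set T : ℝ := ∑' K : Fin 4 → ℤ, (1 + freqNormSq K) ^ (N + 2) * ‖C K‖ with hT
  have hnn : ∀ K : Fin 4 → ℤ, 0 ≤ (1 + freqNormSq K) ^ (N + 2) * ‖C K‖ := fun K =>
    mul_nonneg (one_add_freqNormSq_pow_nonneg K _) (norm_nonneg _)
  have hle : ∀ K : Fin 4 → ℤ, (1 + freqNormSq K) ^ (N + 2) * ‖C K‖ ≤ T := fun K =>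
    hs.le_tsum K fun K' _ => hnn K'
  have hT0 : 0 ≤ T := tsum_nonneg hnn
  -- pointwise bound
  have hpt : ∀ m : ℤ × (Fin 3 → ℤ), ENNReal.ofReal ((Λ m) ^ N) *
      ‖(((Λ m : ℝ) : ℂ)) • C (Fin.cons m.1 m.2)‖ₑ ^ 2 ≤
      ENNReal.ofReal T * ‖C (Fin.cons m.1 m.2)‖ₑ := by
    intro m
    have hw := wt_nonneg m
    have h1 : (Λ m) ^ (N + 2) ≤ (1 + freqNormSq (Fin.cons m.1 m.2 : Fin 4 → ℤ)) ^ (N + 2) :=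
      pow_le_pow_left₀ hw (wt_le_one_add_freqNormSq_cons m) _
    have h2 : (Λ m) ^ N * ‖(((Λ m : ℝ) : ℂ)) • C (Fin.cons m.1 m.2)‖ ^ 2 ≤ T * ‖C (Fin.cons m.1 m.2)‖ := by
      rw [norm_smul, Complex.norm_real, Real.norm_of_nonneg hw, mul_pow, ← mul_assoc, ← pow_add]
      calc (Λ m) ^ (N + 2) * ‖C (Fin.cons m.1 m.2)‖ ^ 2
          = ((Λ m) ^ (N + 2) * ‖C (Fin.cons m.1 m.2)‖) * ‖C (Fin.cons m.1 m.2)‖ := by ring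
        _ ≤ ((1 + freqNormSq (Fin.cons m.1 m.2 : Fin 4 → ℤ)) ^ (N + 2) * ‖C (Fin.cons m.1 m.2)‖) *
              ‖C (Fin.cons m.1 m.2)‖ := by gcongr
        _ ≤ T * ‖C (Fin.cons m.1 m.2)‖ := mul_le_mul_of_nonneg_right (hle _) (norm_nonneg _)
    calc ENNReal.ofReal ((Λ m) ^ N) * ‖(((Λ m : ℝ) : ℂ)) • C (Fin.cons m.1 m.2)‖ₑ ^ 2
        = ENNReal.ofReal ((Λ m) ^ N * ‖(((Λ m : ℝ) : ℂ)) • C (Fin.cons m.1 m.2)‖ ^ 2) := by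
          rw [ENNReal.ofReal_mul (pow_nonneg hw N), ← ofReal_norm, ← ENNReal.ofReal_pow (norm_nonneg _)]
      _ ≤ ENNReal.ofReal (T * ‖C (Fin.cons m.1 m.2)‖) := ENNReal.ofReal_le_ofReal h2
      _ = ENNReal.ofReal T * ‖C (Fin.cons m.1 m.2)‖ₑ := by rw [ENNReal.ofReal_mul hT0, ofReal_norm]
  have hsumC : ∑' m : ℤ × (Fin 3 → ℤ), ‖C (Fin.cons m.1 m.2)‖ₑ ≠ ⊤ := by
    rw [← tsum_eq_tsum_cons (fun K => ‖C K‖ₑ)]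
    have h := hC.summable_norm
    rw [show (fun K : Fin 4 → ℤ => ‖C K‖ₑ) = fun K => ENNReal.ofReal ‖C K‖ from funext fun K => (ofReal_norm _).symm,
      ← ENNReal.ofReal_tsum_of_nonneg (fun K => norm_nonneg _) h]
    exact ENNReal.ofReal_ne_top
  refine ne_top_of_le_ne_top ?_ (ENNReal.tsum_le_tsum hpt)
  rw [ENNReal.tsum_mul_left]
  exact ENNReal.mul_ne_top ENNReal.ofReal_ne_top hsumC

/-- **The weighted `ℓ¹` bound of rapidly decaying families**:
`∑_{(n,k)} (1 + Λ)⟨k⟩ ‖C(n,k)‖ < ∞` (`(1+Λ)⟨k⟩ ≤ 2(1+|K|²)²`). [folklore] -/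
theorem tsum_wt_weight_enorm_ne_top_of_rapidDecay {C : (Fin 4 → ℤ) → EuclideanSpace ℂ (Fin 3)} (hC : RapidDecay C) :
    ∑' m : ℤ × (Fin 3 → ℤ), ENNReal.ofReal ((1 + Λ m) * sobolevWeight 1 m.2) * ‖C (Fin.cons m.1 m.2)‖ₑ ≠ ⊤ := by
  have hs := hC 2
  have hpt : ∀ m : ℤ × (Fin 3 → ℤ), ENNReal.ofReal ((1 + Λ m) * sobolevWeight 1 m.2) * ‖C (Fin.cons m.1 m.2)‖ₑ ≤
      ENNReal.ofReal (2 * ((1 + freqNormSq (Fin.cons m.1 m.2 : Fin 4 → ℤ)) ^ 2 * ‖C (Fin.cons m.1 m.2)‖)) := by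
    intro m
    rw [← ofReal_norm, ← ENNReal.ofReal_mul (mul_nonneg (by linarith [wt_nonneg m]) (sobolevWeight_pos 1 _).le)]
    refine ENNReal.ofReal_le_ofReal ?_
    have h1 : 1 + Λ m ≤ 2 * (1 + freqNormSq (Fin.cons m.1 m.2 : Fin 4 → ℤ)) := by
      have := wt_le_one_add_freqNormSq_cons m
      linarith [freqNormSq_nonneg (Fin.cons m.1 m.2 : Fin 4 → ℤ)]
    have h2 : sobolevWeight 1 m.2 ≤ 1 + freqNormSq (Fin.cons m.1 m.2 : Fin 4 → ℤ) := by
      rw [freqNormSq_cons]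
      have hb := freqNormSq_nonneg m.2
      have hsw : sobolevWeight 1 m.2 ≤ 1 + freqNormSq m.2 := by
        rw [sobolevWeight]
        have h0 : 0 ≤ 1 + freqNormSq m.2 := by linarith
        calc (1 + freqNormSq m.2) ^ ((1 : ℝ) / 2) ≤ (1 + freqNormSq m.2) ^ (1 : ℝ) :=
              Real.rpow_le_rpow_of_exponent_le (by linarith) (by norm_num)
          _ = 1 + freqNormSq m.2 := Real.rpow_one _
      nlinarith [sq_nonneg ((m.1 : ℤ) : ℝ)]
    have h3 : 0 ≤ sobolevWeight 1 m.2 := (sobolevWeight_pos 1 _).le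
    have h4 : 0 ≤ 1 + Λ m := by linarith [wt_nonneg m]
    calc (1 + Λ m) * sobolevWeight 1 m.2 * ‖C (Fin.cons m.1 m.2)‖
        ≤ (2 * (1 + freqNormSq (Fin.cons m.1 m.2 : Fin 4 → ℤ))) * (1 + freqNormSq (Fin.cons m.1 m.2 : Fin 4 → ℤ)) *
            ‖C (Fin.cons m.1 m.2)‖ := by
          refine mul_le_mul_of_nonneg_right ?_ (norm_nonneg _)
          exact mul_le_mul h1 h2 h3 (by linarith [freqNormSq_nonneg (Fin.cons m.1 m.2 : Fin 4 → ℤ)])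
      _ = 2 * ((1 + freqNormSq (Fin.cons m.1 m.2 : Fin 4 → ℤ)) ^ 2 * ‖C (Fin.cons m.1 m.2)‖) := by ring
  refine ne_top_of_le_ne_top ?_ (ENNReal.tsum_le_tsum hpt)
  have hs' : Summable fun m : ℤ × (Fin 3 → ℤ) =>
      2 * ((1 + freqNormSq (Fin.cons m.1 m.2 : Fin 4 → ℤ)) ^ 2 * ‖C (Fin.cons m.1 m.2)‖) :=
    ((summable_cons_iff (fun K : Fin 4 → ℤ => (1 + freqNormSq K) ^ 2 * ‖C K‖)).2 hs).mul_left 2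
  rw [← ENNReal.ofReal_tsum_of_nonneg (fun m => by positivity) hs']
  exact ENNReal.ofReal_ne_top

/-- A family of nonnegative reals with `∑ ofReal < ∞` is summable (with the same sum). [folklore] -/
theorem summable_of_tsum_ofReal_ne_top {α : Type*} {f : α → ℝ} (hf : ∀ a, 0 ≤ f a)
    (h : ∑' a, ENNReal.ofReal (f a) ≠ ⊤) : Summable f := by
  have := ENNReal.summable_toReal h
  refine this.congr fun a => ?_
  rw [ENNReal.toReal_ofReal (hf a)]

/-- The one-dimensional inverse-square family is summable on `ℤ`. [folklore] -/
theorem summable_int_inv_sq : Summable fun n : ℤ => (((|((n : ℤ) : ℝ)| + 1) ^ 2)⁻¹) :=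
  summable_of_tsum_ofReal_ne_top (f := fun n : ℤ => (((|((n : ℤ) : ℝ)| + 1) ^ 2)⁻¹))
    (fun n => by positivity) (ne_top_of_le_ne_top ENNReal.ofReal_ne_top (tsum_int_inv_sq_le le_rfl))

/-- The lattice family `|k|⁻⁴` is summable on `ℤ³` (junk `0` at `k = 0`). [folklore] -/
theorem summable_inv_freqNormSq_sq : Summable fun k : Fin 3 → ℤ => ((freqNormSq k)⁻¹) ^ 2 := by
  refine summable_of_tsum_ofReal_ne_top (f := fun k : Fin 3 → ℤ => ((freqNormSq k)⁻¹) ^ 2)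
    (fun k => sq_nonneg _) ?_
  have : (fun k : Fin 3 → ℤ => ENNReal.ofReal (((freqNormSq k)⁻¹) ^ 2)) =
      fun k => ENNReal.ofReal ((freqNormSq k)⁻¹) ^ 2 := by
    funext k; rw [ENNReal.ofReal_pow (inv_nonneg.2 (freqNormSq_nonneg k))]
  rw [this]
  exact zConst_ne_top

/-- `Λ⁻⁴ ≤ (|n|+1)⁻² |k|⁻⁴` off `k = 0`. [folklore] -/
theorem wt_inv_pow_four_le {m : ℤ × (Fin 3 → ℤ)} (hm : m.2 ≠ 0) :
    ((Λ m) ^ 4)⁻¹ ≤ (((|((m.1 : ℤ) : ℝ)| + 1) ^ 2)⁻¹) * ((freqNormSq m.2)⁻¹) ^ 2 := by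
  have h1 : 1 ≤ freqNormSq m.2 := Torus.one_le_freqNormSq hm
  have h1' : 0 < freqNormSq m.2 := by linarith
  have ha : 0 ≤ |((m.1 : ℤ) : ℝ)| := abs_nonneg _
  have hpos : 0 < (|((m.1 : ℤ) : ℝ)| + 1) ^ 2 * (freqNormSq m.2) ^ 2 := by positivity
  rw [inv_pow, ← mul_inv]
  refine inv_anti₀ hpos ?_
  have h2 : (|((m.1 : ℤ) : ℝ)| + 1) ^ 2 ≤ (Λ m) ^ 2 := by
    apply pow_le_pow_left₀ (by positivity); change |((m.1 : ℤ) : ℝ)| + 1 ≤ |((m.1 : ℤ) : ℝ)| + freqNormSq m.2; linarith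
  have h3 : (freqNormSq m.2) ^ 2 ≤ (Λ m) ^ 2 := by
    apply pow_le_pow_left₀ (by positivity); change freqNormSq m.2 ≤ |((m.1 : ℤ) : ℝ)| + freqNormSq m.2; linarith
  calc (|((m.1 : ℤ) : ℝ)| + 1) ^ 2 * (freqNormSq m.2) ^ 2 ≤ (Λ m) ^ 2 * (Λ m) ^ 2 :=
        mul_le_mul h2 h3 (by positivity) (by positivity)
    _ = (Λ m) ^ 4 := by ring

/-- **Rapid decay from parabolic moments**: if `x` vanishes on the zero spatial modes and has all
moments `∑ Λ^N ‖x‖² < ∞`, then the coefficient family `K ↦ (x/Λ)(K₀, tail K)` is rapidly decaying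
on `ℤ⁴`. [folklore] -/
theorem rapidDecay_of_moments {x : ℤ × (Fin 3 → ℤ) → EuclideanSpace ℂ (Fin 3)} (hx : ∀ n : ℤ, x (n, 0) = 0)
    (hmom : ∀ N : ℕ, ∑' m, ENNReal.ofReal ((Λ m) ^ N) * ‖x m‖ₑ ^ 2 ≠ ⊤) :
    RapidDecay (fun K : Fin 4 → ℤ => (𝐜 x) (K 0, Fin.tail K)) := by
  intro M
  -- reduce to the lattice
  rw [← summable_cons_iff]
  simp only [Fin.cons_zero, Fin.tail_cons, Prod.mk.eta]
  -- the two summable majorants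
  have ha : Summable fun m : ℤ × (Fin 3 → ℤ) =>
      (((|((m.1 : ℤ) : ℝ)| + 1) ^ 2)⁻¹) * ((freqNormSq m.2)⁻¹) ^ 2 :=
    summable_int_inv_sq.mul_of_nonneg summable_inv_freqNormSq_sq (fun n => by positivity)
      (fun k => by positivity)
  have hb : Summable fun m : ℤ × (Fin 3 → ℤ) => (Λ m) ^ (4 * M + 2) * ‖x m‖ ^ 2 := by
    refine summable_of_tsum_ofReal_ne_top (fun m => mul_nonneg (pow_nonneg (wt_nonneg m) _) (sq_nonneg _)) ?_
    have : (fun m : ℤ × (Fin 3 → ℤ) => ENNReal.ofReal ((Λ m) ^ (4 * M + 2) * ‖x m‖ ^ 2)) =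
        fun m => ENNReal.ofReal ((Λ m) ^ (4 * M + 2)) * ‖x m‖ₑ ^ 2 := by
      funext m
      rw [ENNReal.ofReal_mul (pow_nonneg (wt_nonneg m) _), ← ofReal_norm, ENNReal.ofReal_pow (norm_nonneg _)]
    rw [this]
    exact hmom _
  refine Summable.of_nonneg_of_le (fun m => mul_nonneg (one_add_freqNormSq_pow_nonneg _ _) (norm_nonneg _))
    (fun m => ?_) ((ha.add hb).mul_left ((4 : ℝ) ^ M))
  -- pointwise: `(1+|K|²)^M ‖(x/Λ)(m)‖ ≤ 4^M (Λ⁻⁴ + Λ^{4M+2}‖x‖²)`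
  by_cases hm : m.2 = 0
  · have : x m = 0 := by
      have := hx m.1
      rwa [show ((m.1, 0) : ℤ × (Fin 3 → ℤ)) = m from Prod.ext rfl hm.symm] at this
    rw [this, smul_zero, norm_zero, mul_zero]
    exact mul_nonneg (pow_nonneg (by norm_num) M)
      (add_nonneg (by positivity) (mul_nonneg (pow_nonneg (wt_nonneg m) _) (sq_nonneg _)))
  · have hL : 1 ≤ Λ m := one_le_wt hm
    have hL0 : 0 < Λ m := by linarith
    rw [norm_smul, Complex.norm_real, Real.norm_of_nonneg (inv_nonneg.2 hL0.le)]
    have h1 : (1 + freqNormSq (Fin.cons m.1 m.2 : Fin 4 → ℤ)) ^ M ≤ (4 : ℝ) ^ M * (Λ m) ^ (2 * M) := by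
      rw [pow_mul, ← mul_pow]
      exact pow_le_pow_left₀ (by linarith [freqNormSq_nonneg (Fin.cons m.1 m.2 : Fin 4 → ℤ)])
        (one_add_freqNormSq_cons_le hm) M
    have h2 : (Λ m) ^ (2 * M) * ((Λ m)⁻¹ * ‖x m‖) ≤ ((Λ m) ^ 4)⁻¹ + (Λ m) ^ (4 * M + 2) * ‖x m‖ ^ 2 := by
      -- `Λ^{2M-1} a = Λ⁻² · Λ^{2M+1} a ≤ (Λ⁻⁴ + Λ^{4M+2} a²)/2 · 2`
      have e : (Λ m) ^ (2 * M) * ((Λ m)⁻¹ * ‖x m‖) = ((Λ m) ^ 2)⁻¹ * ((Λ m) ^ (2 * M + 1) * ‖x m‖) := by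
        field_simp
        ring
      rw [e]
      have key : ∀ A B : ℝ, A * B ≤ A ^ 2 + B ^ 2 := fun A B => by nlinarith [sq_nonneg (A - B)]
      calc ((Λ m) ^ 2)⁻¹ * ((Λ m) ^ (2 * M + 1) * ‖x m‖)
          ≤ (((Λ m) ^ 2)⁻¹) ^ 2 + ((Λ m) ^ (2 * M + 1) * ‖x m‖) ^ 2 := key _ _
        _ = ((Λ m) ^ 4)⁻¹ + (Λ m) ^ (4 * M + 2) * ‖x m‖ ^ 2 := by
            rw [← inv_pow, ← pow_mul, mul_pow, ← pow_mul, show 2 * 2 = 4 by norm_num,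
              show (2 * M + 1) * 2 = 4 * M + 2 by ring, inv_pow]
    calc (1 + freqNormSq (Fin.cons m.1 m.2 : Fin 4 → ℤ)) ^ M * ((Λ m)⁻¹ * ‖x m‖)
        ≤ ((4 : ℝ) ^ M * (Λ m) ^ (2 * M)) * ((Λ m)⁻¹ * ‖x m‖) :=
          mul_le_mul_of_nonneg_right h1 (by positivity)
      _ = (4 : ℝ) ^ M * ((Λ m) ^ (2 * M) * ((Λ m)⁻¹ * ‖x m‖)) := by ring
      _ ≤ (4 : ℝ) ^ M * (((Λ m) ^ 4)⁻¹ + (Λ m) ^ (4 * M + 2) * ‖x m‖ ^ 2) := by gcongr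
      _ ≤ (4 : ℝ) ^ M * ((((|((m.1 : ℤ) : ℝ)| + 1) ^ 2)⁻¹) * ((freqNormSq m.2)⁻¹) ^ 2 +
            (Λ m) ^ (4 * M + 2) * ‖x m‖ ^ 2) := by
          gcongr
          exact wt_inv_pow_four_le hm

/-- The square sum of a family with finite zero-th moment is finite (bookkeeping form). [folklore] -/
theorem tsum_enorm_sq_ne_top_of_moments {x : ℤ × (Fin 3 → ℤ) → EuclideanSpace ℂ (Fin 3)}
    (hmom : ∀ N : ℕ, ∑' m, ENNReal.ofReal ((Λ m) ^ N) * ‖x m‖ₑ ^ 2 ≠ ⊤) :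
    ∑' m, ‖x m‖ₑ ^ 2 ≠ ⊤ := by
  have := hmom 0
  simpa only [pow_zero, ENNReal.ofReal_one, one_mul] using this

end Reindex

/-! ## §B⁗ Real syntheses -/

section RealSynth

variable {d : Type*} [Fintype d] {ι : Type*} [Fintype ι]

/-- **The synthesis of a conjugate-symmetric family is real** (any torus `T^d`, any `ℂ^ι`):
if `∑ ‖c‖ < ∞` and `c(−K) = conj c(K)` then `conj F_c(y) = F_c(y)`. [folklore] -/
theorem conjVec_fourierSynth_of_symm {c : (d → ℤ) → EuclideanSpace ℂ ι} (hc : Summable fun K => ‖c K‖)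
    (hcs : ∀ K, c (-K) = conjVec (c K)) (y : UnitAddTorus d) :
    conjVec (fourierSynth c y) = fourierSynth c y := by
  have hs : Summable fun K : d → ℤ => mFourier K y • c K :=
    Summable.of_norm_bounded hc fun K => (norm_mFourier_smul K y (c K)).le
  rw [fourierSynth, ← conjVecL_apply, ContinuousLinearMap.map_tsum _ hs]
  simp only [conjVecL_apply]
  have h1 : ∀ K : d → ℤ, conjVec (mFourier K y • c K) = mFourier (-K) y • c (-K) := by
    intro K
    rw [conjVec_smul, hcs K, mFourier_neg]
  simp_rw [h1]
  exact (Equiv.neg (d → ℤ)).tsum_eq (fun K => mFourier K y • c K)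

/-- **Real field from a conjugate-symmetric rapidly decaying family**: `Re ∘ F_c` is smooth and
`complexify ∘ (Re ∘ F_c) = F_c`, hence `𝓕(complexify ∘ Re ∘ F_c) = c`. [folklore] -/
theorem realSynth_spec' [DecidableEq d] {c : (d → ℤ) → EuclideanSpace ℂ ι} (hc : RapidDecay c)
    (hcs : ∀ K, c (-K) = conjVec (c K)) :
    IsSmooth (fun y : UnitAddTorus d => realPart (fourierSynth c y)) ∧
      (complexify ∘ fun y : UnitAddTorus d => realPart (fourierSynth c y)) = fourierSynth c ∧
      ∀ K, mFourierCoeff (complexify ∘ fun y : UnitAddTorus d => realPart (fourierSynth c y)) K = c K := by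
  have hreal : (complexify ∘ fun y : UnitAddTorus d => realPart (fourierSynth c y)) = fourierSynth c := by
    funext y
    exact complexify_realPart (conjVec_fourierSynth_of_symm hc.summable_norm hcs y)
  refine ⟨?_, hreal, fun K => ?_⟩
  · exact hc.isSmooth_fourierSynth.comp_clm (realPart (ι := ι))
  · rw [hreal, hc.mFourierCoeff_fourierSynth]

end RealSynth

/-! ## §C⁗ The slice `H¹` bound -/

section SliceBound

/-- **Slices of a synthesis on `T⁴` are syntheses on `T³`** of the time-summed families: for a
summable family `C` on `ℤ⁴`,
`F_C (Fin.cons c x) = F_E (x)` with `E(k) = ∑_n e_n(c) • C(n, k)`. [folklore] -/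
theorem fourierSynth_cons_eq {C : (Fin 4 → ℤ) → EuclideanSpace ℂ (Fin 3)} (hC : Summable fun K => ‖C K‖)
    (c : UnitAddCircle) (x : UnitAddTorus (Fin 3)) :
    fourierSynth C (Fin.cons c x) =
      ∑' k : Fin 3 → ℤ, mFourier k x • ∑' n : ℤ, (fourier n c : ℂ) • C (Fin.cons n k) := by
  -- the family on `ℤ³ × ℤ` (space first), absolutely summable
  set F : (Fin 3 → ℤ) × ℤ → EuclideanSpace ℂ (Fin 3) := fun q =>
    mFourier (Fin.cons q.2 q.1 : Fin 4 → ℤ) (Fin.cons c x : UnitAddTorus (Fin 4)) • C (Fin.cons q.2 q.1) with hF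
  have hFn : ∀ q, ‖F q‖ = ‖C (Fin.cons q.2 q.1)‖ := fun q => norm_mFourier_smul _ _ _
  have hCs : Summable fun q : (Fin 3 → ℤ) × ℤ => ‖C (Fin.cons q.2 q.1)‖ := by
    have h1 : Summable fun p : ℤ × (Fin 3 → ℤ) => ‖C (Fin.cons p.1 p.2)‖ :=
      (summable_cons_iff (fun K : Fin 4 → ℤ => ‖C K‖)).2 hC
    exact (Equiv.prodComm ℤ (Fin 3 → ℤ)).symm.summable_iff.2 h1
  have hFs : Summable F := Summable.of_norm_bounded hCs fun q => (hFn q).le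
  -- rewrite the synthesis as the sum of `F`
  have h1 : fourierSynth C (Fin.cons c x) = ∑' q : (Fin 3 → ℤ) × ℤ, F q := by
    rw [fourierSynth, tsum_eq_tsum_cons, ← (Equiv.prodComm ℤ (Fin 3 → ℤ)).symm.tsum_eq]
    rfl
  rw [h1, hFs.tsum_prod]
  refine tsum_congr fun k => ?_
  have hk : Summable fun n : ℤ => (fourier n c : ℂ) • C (Fin.cons n k) :=
    Summable.of_norm_bounded (hCs.prod_factor k) fun n => by
      rw [norm_smul]
      have : ‖(fourier n c : ℂ)‖ = 1 := by rw [fourier_apply, Circle.norm_coe]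
      rw [this, one_mul]
  rw [← hk.tsum_const_smul (mFourier k x)]
  refine tsum_congr fun n => ?_
  simp only [hF, mFourier_cons, smul_smul, mul_comm]

/-- **Slice coefficients**: for a rapidly decaying family `C` on `ℤ⁴`, the `k`-th Fourier
coefficient of the slice `x ↦ F_C(Fin.cons c x)` is `∑_n e_n(c) • C(n,k)`. [folklore] -/
theorem mFourierCoeff_timeSlice_fourierSynth {C : (Fin 4 → ℤ) → EuclideanSpace ℂ (Fin 3)} (hC : RapidDecay C)
    (c : UnitAddCircle) (k : Fin 3 → ℤ) :
    mFourierCoeff (timeSlice (fourierSynth C) c) k = ∑' n : ℤ, (fourier n c : ℂ) • C (Fin.cons n k) := by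
  have hCn := hC.summable_norm
  -- summability of the time-summed family
  have hE : Summable fun k : Fin 3 → ℤ => ‖∑' n : ℤ, (fourier n c : ℂ) • C (Fin.cons n k)‖ := by
    have h1 : Summable fun p : ℤ × (Fin 3 → ℤ) => ‖C (Fin.cons p.1 p.2)‖ :=
      (summable_cons_iff (fun K : Fin 4 → ℤ => ‖C K‖)).2 hCn
    have h2 : Summable fun q : (Fin 3 → ℤ) × ℤ => ‖C (Fin.cons q.2 q.1)‖ :=
      (Equiv.prodComm ℤ (Fin 3 → ℤ)).symm.summable_iff.2 h1
    refine Summable.of_nonneg_of_le (fun k => norm_nonneg _) (fun k => ?_) h2.prod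
    refine (norm_tsum_le_tsum_norm (h2.prod_factor k |>.congr fun n => ?_)).trans (le_of_eq ?_)
    · rw [norm_smul, fourier_apply, Circle.norm_coe, one_mul]
    · refine tsum_congr fun n => ?_
      rw [norm_smul, fourier_apply, Circle.norm_coe, one_mul]
  have hfun : timeSlice (fourierSynth C) c =
      fun x => ∑' k : Fin 3 → ℤ, mFourier k x • ∑' n : ℤ, (fourier n c : ℂ) • C (Fin.cons n k) := by
    funext x
    rw [timeSlice_apply, fourierSynth_cons_eq hCn]
  rw [hfun, mFourierCoeff_tsum_mFourier_smul hE]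

/-- **The time sum is bounded by the parabolic column**: for a lattice family `e` vanishing on
the zero spatial modes, `‖∑_n e_n(c) • (e/Λ)(n,k)‖² ≤ (3/|k|²) ∑_n ‖e(n,k)‖²` in `ℝ≥0∞`
(Cauchy–Schwarz and `∑_n Λ(n,k)⁻² ≤ 3/|k|²`). [folklore] -/
theorem enorm_tsum_fourier_smul_cw_sq_le (e : ℤ × (Fin 3 → ℤ) → EuclideanSpace ℂ (Fin 3))
    (he : ∀ n : ℤ, e (n, 0) = 0) (c : UnitAddCircle) (k : Fin 3 → ℤ) :
    ‖∑' n : ℤ, (fourier n c : ℂ) • (𝐜 e) (n, k)‖ₑ ^ 2 ≤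
      ENNReal.ofReal (3 / freqNormSq k) * ∑' n : ℤ, ‖e (n, k)‖ₑ ^ 2 := by
  by_cases hk : k = 0
  · subst hk
    have : ∀ n : ℤ, (fourier n c : ℂ) • (𝐜 e) (n, 0) = 0 := fun n => by
      simp only [he n, smul_zero]
    rw [tsum_congr this, tsum_zero, enorm_zero, zero_pow two_ne_zero]
    exact bot_le
  · have hb : 1 ≤ freqNormSq k := Torus.one_le_freqNormSq hk
    calc ‖∑' n : ℤ, (fourier n c : ℂ) • (𝐜 e) (n, k)‖ₑ ^ 2
        ≤ (∑' n : ℤ, ‖(fourier n c : ℂ) • (𝐜 e) (n, k)‖ₑ) ^ 2 := by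
          gcongr
          exact enorm_tsum_le_tsum_enorm
      _ = (∑' n : ℤ, ENNReal.ofReal ((Λ (n, k))⁻¹) * ‖e (n, k)‖ₑ) ^ 2 := by
          congr 1
          refine tsum_congr fun n => ?_
          rw [enorm_smul, enorm_cw]
          have : ‖(fourier n c : ℂ)‖ₑ = 1 := by
            rw [← ofReal_norm, fourier_apply, Circle.norm_coe, ENNReal.ofReal_one]
          rw [this, one_mul]
      _ ≤ (∑' n : ℤ, ENNReal.ofReal ((Λ (n, k))⁻¹) ^ 2) * ∑' n : ℤ, ‖e (n, k)‖ₑ ^ 2 := tsum_mul_sq_le _ _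
      _ ≤ ENNReal.ofReal (3 / freqNormSq k) * ∑' n : ℤ, ‖e (n, k)‖ₑ ^ 2 := by
          gcongr
          calc ∑' n : ℤ, ENNReal.ofReal ((Λ (n, k))⁻¹) ^ 2
              = ∑' n : ℤ, ENNReal.ofReal (((|((n : ℤ) : ℝ)| + freqNormSq k) ^ 2)⁻¹) := by
                refine tsum_congr fun n => ?_
                rw [← ENNReal.ofReal_pow (inv_nonneg.2 (wt_nonneg _)), ← inv_pow]
            _ ≤ ENNReal.ofReal (3 / freqNormSq k) := tsum_int_inv_sq_le hb

/-- **The slice `H¹` bound** (embedding of the maximal-regularity class into `C(S¹; H¹(T³))`,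
Iooss 1972, §2, on the Fourier side): let `D : T⁴ → ℝ³` be smooth with space–time coefficients
`𝓕(complexify ∘ D)(n,k) = (e/Λ)(n,k)` for a lattice family `e ∈ ℓ²` vanishing on the zero
spatial modes. Then every time slice satisfies
`∫ ‖D(c,·)‖² + ‖∇D(c,·)‖₂² ≤ 3(1 + 4π²) ∑ ‖e‖²`. [folklore] -/
theorem slice_h1_le {D : UnitAddTorus (Fin 4) → EuclideanSpace ℝ (Fin 3)} (hD : IsSmooth D)
    (e : ℤ × (Fin 3 → ℤ) → EuclideanSpace ℂ (Fin 3)) (he0 : ∀ n : ℤ, e (n, 0) = 0)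
    (he : ∀ m : ℤ × (Fin 3 → ℤ), mFourierCoeff (complexify ∘ D) (Fin.cons m.1 m.2) = (𝐜 e) m)
    (he2 : ∑' m, ‖e m‖ₑ ^ 2 ≠ ⊤) (c : UnitAddCircle) :
    (∫ x, ‖timeSlice D c x‖ ^ 2) + gradNormSq (timeSlice D c) ≤
      (3 * (1 + 4 * Real.pi ^ 2)) * (∑' m, ‖e m‖ₑ ^ 2).toReal := by
  -- the coefficient family of `complexify ∘ D` and the slice
  set C : (Fin 4 → ℤ) → EuclideanSpace ℂ (Fin 3) := mFourierCoeff (complexify ∘ D) with hC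
  have hDc : IsSmooth (complexify ∘ D) := hD.comp_clm complexify.toContinuousLinearMap
  have hCr : RapidDecay C := hDc.rapidDecay_mFourierCoeff
  have hsyn : fourierSynth C = complexify ∘ D := hDc.fourierSynth_mFourierCoeff
  have hg : IsSmooth (timeSlice D c) := hD.timeSlice c
  have hslice : complexify ∘ timeSlice D c = timeSlice (fourierSynth C) c := by
    funext x; simp [hsyn]
  -- slice coefficients and their bound
  have hcoef : ∀ k : Fin 3 → ℤ, mFourierCoeff (complexify ∘ timeSlice D c) k =
      ∑' n : ℤ, (fourier n c : ℂ) • (𝐜 e) (n, k) := by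
    intro k
    rw [hslice, mFourierCoeff_timeSlice_fourierSynth hCr]
    refine tsum_congr fun n => ?_
    exact congrArg (fun v => (fourier n c : ℂ) • v) (he (n, k))
  have hbound : ∀ k : Fin 3 → ℤ, ‖mFourierCoeff (complexify ∘ timeSlice D c) k‖ₑ ^ 2 ≤
      ENNReal.ofReal (3 / freqNormSq k) * ∑' n : ℤ, ‖e (n, k)‖ₑ ^ 2 := by
    intro k
    rw [hcoef k]
    exact enorm_tsum_fourier_smul_cw_sq_le e he0 c k
  -- Parseval pieces in `ℝ≥0∞`
  set S : ℝ≥0∞ := ∑' m : ℤ × (Fin 3 → ℤ), ‖e m‖ₑ ^ 2 with hS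
  have hcol : ∑' k : Fin 3 → ℤ, ∑' n : ℤ, ‖e (n, k)‖ₑ ^ 2 = S := by
    rw [hS, ENNReal.tsum_prod', ENNReal.tsum_comm]
  have hA : ENNReal.ofReal (∫ x, ‖timeSlice D c x‖ ^ 2) ≤ 3 * S := by
    have hcont : Continuous (complexify ∘ timeSlice D c) := continuous_complexify.comp hg.continuous
    have hpar := tsum_enorm_sq_mFourierCoeff_euclidean hcont
    have hnorm : (∫ x, ‖(complexify ∘ timeSlice D c) x‖ ^ 2) = ∫ x, ‖timeSlice D c x‖ ^ 2 := by
      congr 1; funext x; simp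
    rw [hnorm] at hpar
    rw [← hpar]
    calc ∑' k : Fin 3 → ℤ, ‖mFourierCoeff (complexify ∘ timeSlice D c) k‖ₑ ^ 2
        ≤ ∑' k : Fin 3 → ℤ, ENNReal.ofReal (3 / freqNormSq k) * ∑' n : ℤ, ‖e (n, k)‖ₑ ^ 2 :=
          ENNReal.tsum_le_tsum hbound
      _ ≤ ∑' k : Fin 3 → ℤ, 3 * ∑' n : ℤ, ‖e (n, k)‖ₑ ^ 2 := by
          refine ENNReal.tsum_le_tsum fun k => ?_
          by_cases hk : k = 0
          · subst hk
            have : ∀ n : ℤ, ‖e (n, 0)‖ₑ ^ 2 = 0 := fun n => by rw [he0 n, enorm_zero, zero_pow two_ne_zero]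
            rw [tsum_congr this, tsum_zero, mul_zero, mul_zero]
          · gcongr
            rw [← ENNReal.ofReal_ofNat 3]
            refine ENNReal.ofReal_le_ofReal (div_le_self (by norm_num) (Torus.one_le_freqNormSq hk))
      _ = 3 * S := by rw [ENNReal.tsum_mul_left, hcol]
  have hB : ENNReal.ofReal (gradNormSq (timeSlice D c)) ≤ ENNReal.ofReal (4 * Real.pi ^ 2) * (3 * S) := by
    have hgrad := tsum_freqNormSq_mul_enorm_sq_mFourierCoeff_complexify hg
    have hpi : (0 : ℝ) < 4 * Real.pi ^ 2 := by positivity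
    have e1 : ENNReal.ofReal (gradNormSq (timeSlice D c)) =
        ENNReal.ofReal (4 * Real.pi ^ 2) * ENNReal.ofReal ((4 * Real.pi ^ 2)⁻¹ * gradNormSq (timeSlice D c)) := by
      rw [← ENNReal.ofReal_mul hpi.le, ← mul_assoc, mul_inv_cancel₀ hpi.ne', one_mul]
    rw [e1, ← hgrad]
    gcongr
    calc ∑' k : Fin 3 → ℤ, ENNReal.ofReal (freqNormSq k) * ‖mFourierCoeff (complexify ∘ timeSlice D c) k‖ₑ ^ 2
        ≤ ∑' k : Fin 3 → ℤ, ENNReal.ofReal (freqNormSq k) *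
            (ENNReal.ofReal (3 / freqNormSq k) * ∑' n : ℤ, ‖e (n, k)‖ₑ ^ 2) := by
          refine ENNReal.tsum_le_tsum fun k => ?_
          gcongr
          exact hbound k
      _ ≤ ∑' k : Fin 3 → ℤ, 3 * ∑' n : ℤ, ‖e (n, k)‖ₑ ^ 2 := by
          refine ENNReal.tsum_le_tsum fun k => ?_
          rw [← mul_assoc]
          by_cases hk : k = 0
          · subst hk
            have : ∀ n : ℤ, ‖e (n, 0)‖ₑ ^ 2 = 0 := fun n => by rw [he0 n, enorm_zero, zero_pow two_ne_zero]
            rw [tsum_congr this, tsum_zero, mul_zero, mul_zero]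
          · gcongr
            have hb : 1 ≤ freqNormSq k := Torus.one_le_freqNormSq hk
            rw [← ENNReal.ofReal_mul (freqNormSq_nonneg k), ← ENNReal.ofReal_ofNat 3]
            refine ENNReal.ofReal_le_ofReal (le_of_eq ?_)
            field_simp
      _ = 3 * S := by rw [ENNReal.tsum_mul_left, hcol]
  -- back to `ℝ`
  have hSt : S ≠ ⊤ := he2
  have h3S : (3 * S).toReal = 3 * S.toReal := by rw [ENNReal.toReal_mul]; norm_num
  have hA' : (∫ x, ‖timeSlice D c x‖ ^ 2) ≤ 3 * S.toReal := by
    have := ENNReal.toReal_mono (ENNReal.mul_ne_top (by norm_num) hSt) hA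
    rwa [ENNReal.toReal_ofReal (integral_nonneg fun x => sq_nonneg _), h3S] at this
  have hB' : gradNormSq (timeSlice D c) ≤ 4 * Real.pi ^ 2 * (3 * S.toReal) := by
    have := ENNReal.toReal_mono (ENNReal.mul_ne_top ENNReal.ofReal_ne_top (ENNReal.mul_ne_top (by norm_num) hSt)) hB
    rwa [ENNReal.toReal_ofReal (gradNormSq_nonneg _), ENNReal.toReal_mul, ENNReal.toReal_ofReal (by positivity),
      h3S] at this
  nlinarith [ENNReal.toReal_nonneg (a := S)]

end SliceBound

end TimePeriodicLattice

end Literature.Analysis.FluidPDE
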